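import Literature.AlgebraicGeometry.ModuliOfAbelianVarieties.SiegelAdelicMarkingIsogenyQuotient   -- ★ (β1) `SiegelAdelicMarking.exists_quotientMarking`
import HarnessLib

/-!
# The marking of an IDEAL QUOTIENT `A → A ⊗ 𝔞⁻¹` of a marked complex abelian variety whose `O`-action reads through the marking

Topic `AlgebraicGeometry/ModuliOfAbelianVarieties`; namespace `Literature.AlgebraicGeometry.ModuliOfAbelianVarieties`.  THEOREMS ONLY (no definition,
no named fact, no instance, no notation, no `sorry`).  Cell `hodgecm-mathlib`, FLOOR 0, P6 «MOD programme» (crux hLiu418 = stmt-HodgeConjecture-24832, `--supports`),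
X-LEAF sheet line (A-p01 (g28) memo `MEMO-ESHEET-organs.v1` §2 (S2b) «SERRE TENSOR OF A MARKED FIBRE IS MARKED BY THE `z`-TRANSLATE»; «L4» LA4-plan (g0) DEAL #25).

SETTING ([Milne2005ShimuraVarieties] §6 Thm. 6.11 and p. 75; [Deligne1971TravauxShimura] 4.11–4.12; [Shimura1998] §18.3, §18.6): `A` a complex abelian variety marked by
`[J, r′]` (★ `SiegelAdelicMarking`: torsion parametrisation `u = m.r : V = ℚ^{2g} → A(ℂ)` with kernel `Λ_{r′}`), and `c : A → B` a homomorphism ONTO `B` (on ℂ-points) with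
`dim B = g`.  If the kernel of `c` is `u(Λ_r)` for an adelic point `r` with `Λ_{r′} ⊆ Λ_r` then `B` is marked by `[J, r]` — the SAME complex structure — with torsion
parametrisation `u_B = c ∘ u` (§1, the `γq = 1` instance of ★ (β1) `exists_quotientMarking`): «the cover reads `id` on `V_ℝ`».  When an `O`-action `ρ` on `A` READS
through the marking as matrices `M : O → M_{2g}(ℚ)` (`ρ(x)(u v) = u(M x · v)` — the last clause of the P6 σ1 organ `Reads`) and the kernel of `c` on ℂ-points is the
`𝔞`-torsion `A[𝔞]` of a set `𝔞 ⊆ O` acting integrally on `Λ_{r′}` (the Serre cover `A → A ⊗_O 𝔞⁻¹` of an invertible ideal: ★ `SerreTensorIntegralIdealCoverKernel`,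
(t1′) of `CoverKerE`), the kernel is `u(𝔞⁻¹Λ_{r′})` with `𝔞⁻¹Λ_{r′} := {v | ∀ x ∈ 𝔞, M x · v ∈ Λ_{r′}}`; so `B` is marked by `[J, r]` for ANY adelic `r` cutting out
`𝔞⁻¹Λ_{r′}` (§2) — Shimura՚s «`A ⊗ 𝔞⁻¹` has lattice `𝔞⁻¹Λ`», [Shimura1998] §18.6 (proof, p. 127: «r is the restriction of ξ ∘ q to K∕𝔞»), on markings.  The adelic identity `Λ_{b̃(z)·r′} = 𝔞⁻¹Λ_{r′}`
for `[z] = 𝔞⁻¹` (pattern ★ `CMStructure.act_mem_latticeOfGL_mul_iff_of_rational_reading`) is NOT restated here: it enters as the hypothesis `hr`.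

* §1 `SiegelAdelicMarking.exists_marking_of_cover` — same-`J` quotient marking (★ (β1) at `γq = 1`).
* §2 **`SiegelAdelicMarking.exists_marking_of_idealKernel`** — (S2b): the `𝔞`-quotient of an `[J, r′]`-marked variety whose action reads `M` is `[J, r]`-marked for
  any `r` with `Λ_r = 𝔞⁻¹Λ_{r′}`, the cover reading `id` on `V_ℝ`; `SiegelAdelicMarking.map_r_eq_one_iff_forall_mulVec_mem` — the kernel translation (K).
Budgets: default heartbeats.

References: [Milne2005ShimuraVarieties] J. S. Milne, *Introduction to Shimura varieties* (2005), §6 Thm. 6.11 p. 74 and p. 75; [Deligne1971TravauxShimura] P. Deligne,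
*Travaux de Shimura*, Sém. Bourbaki 389 (1971), 4.11–4.12 pp. 148–149; [Shimura1998] G. Shimura, *Abelian Varieties with Complex Multiplication and Modular Functions*
(1998), §18.3 pp. 122–123 and §18.6 pp. 124–127; [MumfordAV1970] D. Mumford, *Abelian Varieties* (1970), §7 Thm. 4 (p. 72).
HC_CM is proved only modulo the printed citations (2 remaining named inputs hLiu418 24832, h413 24833) until rung 0 closes — count-neutral.
-/

set_option autoImplicit false

noncomputable section

open CategoryTheory AlgebraicGeometry Matrix
open Literature.AlgebraicGeometry.Motives (SchemeOver ComplexPoints AlgPoints specOver AbelianVariety)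
open Literature.NumberTheory.Automorphic (siegelUpperHalfSpace)
open Literature.NumberTheory.Adeles (latticeOfGL)

namespace Literature.AlgebraicGeometry.ModuliOfAbelianVarieties

open SiegelModuli

/-! ## §1 Same-`J` quotient marking -/

/-- **The quotient of an `[J, r′]`-marked variety by `u(Λ_r)` is `[J, r]`-marked, the cover reading `id` on `V_ℝ`** (★ (β1) `exists_quotientMarking` at `γq = 1`):
for `c : A → B` onto (on ℂ-points), `dim B = g`, `Λ_{r′} ⊆ Λ_r` and `c(u v) = 1 ↔ v ∈ Λ_r`, there is a marking of `B` by `[J, r]` with `u_B v = c(u v)`.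
[cite: Milne2005ShimuraVarieties, §6 Thm. 6.11 p. 74 and p. 75] [cite: Deligne1971TravauxShimura, 4.11–4.12 pp. 148–149] -/
theorem SiegelAdelicMarking.exists_marking_of_cover {g : ℕ} {δ : Fin g → ℕ} (hδ : IsPolarizationType δ)
    (Z : Matrix (Fin g) (Fin g) ℂ) (hZ : Z ∈ siegelUpperHalfSpace g) (r' r : gspFinAdelic δ) (A B : AbelianVariety ℂ)
    (m : SiegelAdelicMarking ⟨jOfSiegel δ Z, SiegelComplexRecordSystem.jOfSiegel_mem_C0pm hδ.1 hZ⟩ r' A)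
    (c : A ⟶ B) (hdim : B.dim = g)
    (hsub : ∀ v : Fin g ⊕ Fin g → ℚ, v ∈ latticeOfGL (r' : GL (Fin g ⊕ Fin g) finAdeleQ) →
      v ∈ latticeOfGL (r : GL (Fin g ⊕ Fin g) finAdeleQ))
    (hker : ∀ v : Fin g ⊕ Fin g → ℚ, AlgPoints.map c.hom.hom.hom (m.r v) = 1 ↔
      v ∈ latticeOfGL (r : GL (Fin g ⊕ Fin g) finAdeleQ))
    (hsurj : Function.Surjective (AlgPoints.map (L := ℂ) c.hom.hom.hom : A.Points ℂ → B.Points ℂ)) :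
    ∃ mB : SiegelAdelicMarking ⟨jOfSiegel δ Z, SiegelComplexRecordSystem.jOfSiegel_mem_C0pm hδ.1 hZ⟩ r B,
      ∀ v : Fin g ⊕ Fin g → ℚ, mB.r v = AlgPoints.map c.hom.hom.hom (m.r v) := by
  have hJ : jOfSiegel δ Z =
      conjJ (Matrix.GeneralLinearGroup.map (algebraMap ℚ ℝ) (1 : GL (Fin g ⊕ Fin g) ℚ)) (jOfSiegel δ Z) := by
    rw [map_one, conjJ_one]
  have hQA1 : ∀ v : Fin g ⊕ Fin g → ℚ, v ∈ latticeOfGL (r' : GL (Fin g ⊕ Fin g) finAdeleQ) →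
      ((1 : GL (Fin g ⊕ Fin g) ℚ) : Matrix (Fin g ⊕ Fin g) (Fin g ⊕ Fin g) ℚ) *ᵥ v ∈
        latticeOfGL (r : GL (Fin g ⊕ Fin g) finAdeleQ) := fun v hv => by
    rw [Units.val_one, Matrix.one_mulVec]
    exact hsub v hv
  have hQA3 : ∃ ν : ℚ, 0 < ν ∧ ((1 : GL (Fin g ⊕ Fin g) ℚ) : Matrix (Fin g ⊕ Fin g) (Fin g ⊕ Fin g) ℚ)ᵀ * typeFormOver δ ℚ *
      ((1 : GL (Fin g ⊕ Fin g) ℚ) : Matrix (Fin g ⊕ Fin g) (Fin g ⊕ Fin g) ℚ) = ν • typeFormOver δ ℚ :=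
    ⟨1, one_pos, by rw [Units.val_one, Matrix.transpose_one, Matrix.one_mul, Matrix.mul_one, one_smul]⟩
  have hker' : ∀ v : Fin g ⊕ Fin g → ℚ, AlgPoints.map c.hom.hom.hom (m.r v) = 1 ↔
      ((1 : GL (Fin g ⊕ Fin g) ℚ) : Matrix (Fin g ⊕ Fin g) (Fin g ⊕ Fin g) ℚ) *ᵥ v ∈
        latticeOfGL (r : GL (Fin g ⊕ Fin g) finAdeleQ) := fun v => by
    rw [Units.val_one, Matrix.one_mulVec]
    exact hker v
  obtain ⟨mB, hmB⟩ := SiegelAdelicMarking.exists_quotientMarking hδ Z hZ Z hZ r r' 1 hJ hQA1 hQA3 A B m c hdim hker' hsurj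
  refine ⟨mB, fun v => ?_⟩
  rw [hmB v, inv_one, Units.val_one, Matrix.one_mulVec]

/-! ## §2 (S2b): the `𝔞`-quotient of a marked variety whose action reads through the marking -/

/-- **Kernel translation (K)**: if the `O`-action `ρ` on `A` reads through the marking (`ρ(x)(u v) = u(M x · v)`) and the kernel of `c` on ℂ-points is the
`𝔞`-torsion (`c P = 1 ↔ ∀ x ∈ 𝔞, ρ(x) P = 1`), then `c(u v) = 1 ↔ ∀ x ∈ 𝔞, M x · v ∈ Λ_{r′}` — «`ker (c ∘ u) = 𝔞⁻¹Λ_{r′}`» (★ `r_eq_one_iff_mem_latticeOfGL`: `ker u = Λ_{r′}`).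
[cite: Shimura1998, §18.6 pp. 124–127] [cite: Milne2005ShimuraVarieties, §6 Thm. 6.11 p. 74 and p. 75] -/
theorem SiegelAdelicMarking.map_r_eq_one_iff_forall_mulVec_mem {g : ℕ} {δ : Fin g → ℕ} {J : C0pm δ} {r' : gspFinAdelic δ}
    {A B : AbelianVariety ℂ} (m : SiegelAdelicMarking J r' A) {O : Type} (ρ : O → (A ⟶ A))
    (M : O → Matrix (Fin g ⊕ Fin g) (Fin g ⊕ Fin g) ℚ)
    (hread : ∀ (x : O) (v : Fin g ⊕ Fin g → ℚ), AlgPoints.map (ρ x).hom.hom.hom (m.r v) = m.r (M x *ᵥ v))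
    (𝔞 : Set O) (c : A ⟶ B)
    (hker : ∀ P : A.Points ℂ, AlgPoints.map c.hom.hom.hom P = 1 ↔ ∀ x ∈ 𝔞, AlgPoints.map (ρ x).hom.hom.hom P = 1)
    (v : Fin g ⊕ Fin g → ℚ) :
    AlgPoints.map c.hom.hom.hom (m.r v) = 1 ↔ ∀ x ∈ 𝔞, M x *ᵥ v ∈ latticeOfGL (r' : GL (Fin g ⊕ Fin g) finAdeleQ) := by
  rw [hker]
  refine forall₂_congr fun x _ => ?_
  rw [hread, m.r_eq_one_iff_mem_latticeOfGL]

/-- **(S2b) «THE `𝔞`-QUOTIENT OF AN `[J, r′]`-MARKED VARIETY WHOSE ACTION READS `M` IS `[J, r]`-MARKED FOR ANY `r` CUTTING OUT `𝔞⁻¹Λ_{r′}`, THE COVER READING `id`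
ON `V_ℝ`»** — the marking of the Serre tensor `A ⊗ 𝔞⁻¹` through its cover `c : A → A ⊗ 𝔞⁻¹` (kernel `A[𝔞]` on ℂ-points: hypothesis `hker`, ★ `SerreTensorIntegralIdealCoverKernel` ∕
(t1′) of the sheet law): for `A` marked by `[J, r′]` with an `O`-action reading `ρ(x)(u v) = u(M x · v)`, a set `𝔞 ⊆ O` acting integrally on `Λ_{r′}` (`hint`), an adelic
`r` with `v ∈ Λ_r ↔ ∀ x ∈ 𝔞, M x · v ∈ Λ_{r′}` (`hr`: «`Λ_r = 𝔞⁻¹Λ_{r′}`», e.g. `r = b̃(z)·r′` for `[z] = 𝔞⁻¹`), and `c : A → B` onto with `dim B = g`: `B` is marked by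
`[J, r]` with `u_B = c ∘ u`.  Shimura՚s lattice statement «`A ⊗ 𝔞⁻¹ = ℂ^g ∕ 𝔞⁻¹Λ`» on adelic markings.
[cite: Shimura1998, §18.3 pp. 122–123 and §18.6 pp. 124–127] [cite: Milne2005ShimuraVarieties, §6 Thm. 6.11 p. 74 and p. 75] [cite: Deligne1971TravauxShimura, 4.11–4.12 pp. 148–149] -/
theorem SiegelAdelicMarking.exists_marking_of_idealKernel {g : ℕ} {δ : Fin g → ℕ} (hδ : IsPolarizationType δ)
    (Z : Matrix (Fin g) (Fin g) ℂ) (hZ : Z ∈ siegelUpperHalfSpace g) (r' r : gspFinAdelic δ) (A B : AbelianVariety ℂ)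
    (m : SiegelAdelicMarking ⟨jOfSiegel δ Z, SiegelComplexRecordSystem.jOfSiegel_mem_C0pm hδ.1 hZ⟩ r' A)
    {O : Type} (ρ : O → (A ⟶ A)) (M : O → Matrix (Fin g ⊕ Fin g) (Fin g ⊕ Fin g) ℚ)
    (hread : ∀ (x : O) (v : Fin g ⊕ Fin g → ℚ), AlgPoints.map (ρ x).hom.hom.hom (m.r v) = m.r (M x *ᵥ v))
    (𝔞 : Set O)
    (hint : ∀ v : Fin g ⊕ Fin g → ℚ, v ∈ latticeOfGL (r' : GL (Fin g ⊕ Fin g) finAdeleQ) →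
      ∀ x ∈ 𝔞, M x *ᵥ v ∈ latticeOfGL (r' : GL (Fin g ⊕ Fin g) finAdeleQ))
    (hr : ∀ v : Fin g ⊕ Fin g → ℚ, v ∈ latticeOfGL (r : GL (Fin g ⊕ Fin g) finAdeleQ) ↔
      ∀ x ∈ 𝔞, M x *ᵥ v ∈ latticeOfGL (r' : GL (Fin g ⊕ Fin g) finAdeleQ))
    (c : A ⟶ B) (hdim : B.dim = g)
    (hker : ∀ P : A.Points ℂ, AlgPoints.map c.hom.hom.hom P = 1 ↔ ∀ x ∈ 𝔞, AlgPoints.map (ρ x).hom.hom.hom P = 1)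
    (hsurj : Function.Surjective (AlgPoints.map (L := ℂ) c.hom.hom.hom : A.Points ℂ → B.Points ℂ)) :
    ∃ mB : SiegelAdelicMarking ⟨jOfSiegel δ Z, SiegelComplexRecordSystem.jOfSiegel_mem_C0pm hδ.1 hZ⟩ r B,
      ∀ v : Fin g ⊕ Fin g → ℚ, mB.r v = AlgPoints.map c.hom.hom.hom (m.r v) :=
  SiegelAdelicMarking.exists_marking_of_cover hδ Z hZ r' r A B m c hdim (fun v hv => (hr v).2 (hint v hv))
    (fun v => (m.map_r_eq_one_iff_forall_mulVec_mem ρ M hread 𝔞 c hker v).trans (hr v).symm) hsurj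

end Literature.AlgebraicGeometry.ModuliOfAbelianVarieties

end
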